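import Summits.AtomisticToContinuum.Crystallization.Theses.ReggeStarCoercivity
import Summits.AtomisticToContinuum.Crystallization.Theorems.ReggeStarCoercivityDefectFreeCrystallizesFunnelChart
import Summits.AtomisticToContinuum.Crystallization.Theorems.ReggeStarCoercivityDefectFreeCrystallizesGoodLaw
import Summits.AtomisticToContinuum.Crystallization.Theorems.ReggeStarCoercivityDefectFreeCrystallizesChargeFromFunnelLaw
import Summits.AtomisticToContinuum.Crystallization.Theorems.DefectFreeCrystallizes.Negative.PredicateAPI
import Summits.AtomisticToContinuum.Crystallization.Theorems.PalmUnimodularRigidityChargedPatternCrystallizes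
import Summits.AtomisticToContinuum.Crystallization.Theorems.PalmUnimodularRigidityShellsToBarlowChart
import Literature.Probability.Process.PointStationaryLaw

/-!
# Route β of line `palm-good-law`, kernel-checked in the tree: the crux `DefectFreeCrystallizes` MODULO {R2a′, crux 9226}
# (crux stmt-AtomisticToContinuum-13603; lead c5, skeleton v16)

With R1 = the funnel chart at tolerance `1/20` PROVED (`FunnelChart.stub_funnelChart`), the line's composition is
landed here as two explicit implications (no `sorry`; hypotheses are carried, nothing is claimed unconditionally):

* `chartedFunnelToTube_of_shells` : R2a′ → R2a — the Barlow chart with bond window `(0, 28/25]` of R2a's conclusion is crux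
  9227 `ShellsToBarlowChart` BY NAME (`ShellsToBarlowChart_of`, proved) applied to the `1 %` shells supplied by R2a′;
* `defectFreeCrystallizes_of_chartedFunnelToShells` : R2a′ → `LayeredLawsSelectHcp` (crux 9226) → `DefectFreeCrystallizes`, through
  P1 `PalmGoodLaw.stub_goodLaw`, R1 `FunnelChart.stub_funnelChart`, R3 `ChargeFromFunnelLaw.stub_chargeFromFunnelLaw` (all landed),
  `chargedPatternCrystallizes_proof` (item 2916) and `LennardJonesMinimalDistance_holds`.

R2a′ (`ChartedFunnelToShells`, stated inline as the hypothesis `hR2a`; registered stub `stub_chartedFunnelToShells` of the v16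
skeleton, conjecture-class): a minimising point-stationary `δ`-hard-core law almost surely carried by everywhere-`SetGood`,
Barlow-bond-isomorphic configurations is almost surely carried by configurations every point of which has an `(a/100)`-close-packed
shell at a scale `a ∈ [9/10, 1]` read in the closed `5a/4`-ball (9227's hypothesis verbatim).  All `[folklore]` glue.
-/

noncomputable section

open scoped ENNReal
open Filter Topology MeasureTheory

namespace Summit.AtomisticToContinuum.Crystallization.Theorems.PalmGoodLaw.RouteBeta

open Summit.AtomisticToContinuum.Crystallization.Theses
open Summit.AtomisticToContinuum.Crystallization.Theorems.DefectFreeCrystallizes.Negative.PredicateAPI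
open Literature.MathematicalPhysics.StatisticalMechanics Literature.Geometry.DiscreteGeometry
open Literature.Probability.Process

/-- **R2a from R2a′ and crux 9227 BY NAME.**  If a charted funnel law is almost surely carried by everywhere-`1 %`-shelled
configurations, it is almost surely carried by configurations satisfying verbatim the structural hypothesis of crux 9226: the `1 %`
shells AND a Barlow chart with bond window `(0, 28/25]` — the latter from `ShellsToBarlowChart_of` (crux 9227, proved), the
configuration being non-empty because it contains the root. [folklore] -/
theorem chartedFunnelToTube_of_shells :
    (∀ δ : ℝ, 0 < δ → ∀ P : Measure (Measure (EuclideanSpace ℝ (Fin 3))), IsProbabilityMeasure P →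
      (∀ᵐ μ ∂P, IsRootedHardCore δ μ) → IsPointStationaryLaw P →
      (∫ μ, (∫ y, lennardJones ‖y‖ ∂μ) / 2 ∂P) ≤
        (⨅ Q : PeriodicConfiguration 3, Q.energyPerParticle lennardJones) →
      (∀ᵐ μ ∂P, ∃ S : Set (EuclideanSpace ℝ (Fin 3)),
        μ = (Measure.count : Measure (EuclideanSpace ℝ (Fin 3))).restrict S ∧
        (∀ y ∈ S, SetGood S y) ∧
        ∃ s : ℤ → ℤ, IsHaggSeq s ∧
          ∃ Φ : EuclideanSpace ℝ (Fin 3) → EuclideanSpace ℝ (Fin 3),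
            Set.BijOn Φ (barlowStacking 1 (Real.sqrt (2 / 3)) s) S ∧
            ∀ p ∈ barlowStacking 1 (Real.sqrt (2 / 3)) s, ∀ q ∈ barlowStacking 1 (Real.sqrt (2 / 3)) s,
              (dist p q = 1 ↔ (0 < dist (Φ p) (Φ q) ∧ dist (Φ p) (Φ q) < 6 / 5))) →
      ∀ᵐ μ ∂P, ∃ S : Set (EuclideanSpace ℝ (Fin 3)),
        μ = (Measure.count : Measure (EuclideanSpace ℝ (Fin 3))).restrict S ∧
        ∀ x ∈ S, (∃ a : ℝ, 9 / 10 ≤ a ∧ a ≤ 1 ∧ ∃ T : Finset (EuclideanSpace ℝ (Fin 3)),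
          (↑T : Set (EuclideanSpace ℝ (Fin 3))) =
            (fun y : EuclideanSpace ℝ (Fin 3) => y - x) ''
              {y : EuclideanSpace ℝ (Fin 3) | y ∈ S ∧ y ≠ x ∧ dist y x ≤ 5 / 4 * a} ∧
          (ShellCloseTo (a / 100) T (Finset.image (fun v : EuclideanSpace ℝ (Fin 3) => a • v) fccKissingPattern) ∨
            ShellCloseTo (a / 100) T (Finset.image (fun v : EuclideanSpace ℝ (Fin 3) => a • v) hcpKissingPattern)))) →
    ∀ δ : ℝ, 0 < δ → ∀ P : Measure (Measure (EuclideanSpace ℝ (Fin 3))), IsProbabilityMeasure P →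
      (∀ᵐ μ ∂P, IsRootedHardCore δ μ) → IsPointStationaryLaw P →
      (∫ μ, (∫ y, lennardJones ‖y‖ ∂μ) / 2 ∂P) ≤
        (⨅ Q : PeriodicConfiguration 3, Q.energyPerParticle lennardJones) →
      (∀ᵐ μ ∂P, ∃ S : Set (EuclideanSpace ℝ (Fin 3)),
        μ = (Measure.count : Measure (EuclideanSpace ℝ (Fin 3))).restrict S ∧
        (∀ y ∈ S, SetGood S y) ∧
        ∃ s : ℤ → ℤ, IsHaggSeq s ∧
          ∃ Φ : EuclideanSpace ℝ (Fin 3) → EuclideanSpace ℝ (Fin 3),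
            Set.BijOn Φ (barlowStacking 1 (Real.sqrt (2 / 3)) s) S ∧
            ∀ p ∈ barlowStacking 1 (Real.sqrt (2 / 3)) s, ∀ q ∈ barlowStacking 1 (Real.sqrt (2 / 3)) s,
              (dist p q = 1 ↔ (0 < dist (Φ p) (Φ q) ∧ dist (Φ p) (Φ q) < 6 / 5))) →
      ∀ᵐ μ ∂P, ∃ S : Set (EuclideanSpace ℝ (Fin 3)),
        μ = (Measure.count : Measure (EuclideanSpace ℝ (Fin 3))).restrict S ∧
        (∀ x ∈ S, (∃ a : ℝ, 9 / 10 ≤ a ∧ a ≤ 1 ∧ ∃ T : Finset (EuclideanSpace ℝ (Fin 3)),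
          (↑T : Set (EuclideanSpace ℝ (Fin 3))) =
            (fun y : EuclideanSpace ℝ (Fin 3) => y - x) ''
              {y : EuclideanSpace ℝ (Fin 3) | y ∈ S ∧ y ≠ x ∧ dist y x ≤ 5 / 4 * a} ∧
          (ShellCloseTo (a / 100) T (Finset.image (fun v : EuclideanSpace ℝ (Fin 3) => a • v) fccKissingPattern) ∨
            ShellCloseTo (a / 100) T (Finset.image (fun v : EuclideanSpace ℝ (Fin 3) => a • v) hcpKissingPattern)))) ∧
        (∃ s : ℤ → ℤ, IsHaggSeq s ∧
          ∃ Φ : EuclideanSpace ℝ (Fin 3) → EuclideanSpace ℝ (Fin 3),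
            Set.BijOn Φ (barlowStacking 1 (Real.sqrt (2 / 3)) s) S ∧
            ∀ p ∈ barlowStacking 1 (Real.sqrt (2 / 3)) s, ∀ q ∈ barlowStacking 1 (Real.sqrt (2 / 3)) s,
              (dist p q = 1 ↔ (0 < dist (Φ p) (Φ q) ∧ dist (Φ p) (Φ q) ≤ 28 / 25))) := by
  intro hR2a δ hδ P hP hcore hstat hE hchart
  filter_upwards [hR2a δ hδ P hP hcore hstat hE hchart, hcore] with μ hμ hc
  obtain ⟨S, rfl, hS⟩ := hμ
  obtain ⟨S₀, h0, -, hμ⟩ := hc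
  -- the root is a point of `S`: `count|S₀ = count|S` forces `0 ∈ S`
  have h0S : (0 : EuclideanSpace ℝ (Fin 3)) ∈ S := by
    have h1 : (Measure.count : Measure (EuclideanSpace ℝ (Fin 3))).restrict S {0} ≠ 0 := by
      rw [hμ]
      exact (count_restrict_singleton_ne_zero_iff S₀ 0).2 h0
    exact (count_restrict_singleton_ne_zero_iff S 0).1 h1
  exact ⟨S, rfl, hS,
    Summit.AtomisticToContinuum.Crystallization.Cruxes.ShellsToBarlowChart.DevelopTheModelGrowthDescent.ShellsToBarlowChart_of
      S ⟨0, h0S⟩ hS⟩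

/-- **Route β concludes the crux MODULO {R2a′, crux 9226}** (lead c5; the v16 skeleton's `defectFreeCrystallizes_skeleton` with its two
remaining registered stubs turned into hypotheses): P1 `PalmGoodLaw.stub_goodLaw` + R1 `FunnelChart.stub_funnelChart` (the `1/20` funnel chart,
PROVED) + R2a′ (`hR2a`) + crux 9227 + crux 9226 (`h9226`) + R3 `ChargeFromFunnelLaw.stub_chargeFromFunnelLaw` ⇒
`GroundStatesChargePeriodic` under the crux's antecedent ⇒ the crux, by `chargedPatternCrystallizes_proof` (item 2916) and
`LennardJonesMinimalDistance_holds`. [folklore] -/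
theorem defectFreeCrystallizes_of_chartedFunnelToShells
    (hR2a : ∀ δ : ℝ, 0 < δ → ∀ P : Measure (Measure (EuclideanSpace ℝ (Fin 3))), IsProbabilityMeasure P →
      (∀ᵐ μ ∂P, IsRootedHardCore δ μ) → IsPointStationaryLaw P →
      (∫ μ, (∫ y, lennardJones ‖y‖ ∂μ) / 2 ∂P) ≤
        (⨅ Q : PeriodicConfiguration 3, Q.energyPerParticle lennardJones) →
      (∀ᵐ μ ∂P, ∃ S : Set (EuclideanSpace ℝ (Fin 3)),
        μ = (Measure.count : Measure (EuclideanSpace ℝ (Fin 3))).restrict S ∧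
        (∀ y ∈ S, SetGood S y) ∧
        ∃ s : ℤ → ℤ, IsHaggSeq s ∧
          ∃ Φ : EuclideanSpace ℝ (Fin 3) → EuclideanSpace ℝ (Fin 3),
            Set.BijOn Φ (barlowStacking 1 (Real.sqrt (2 / 3)) s) S ∧
            ∀ p ∈ barlowStacking 1 (Real.sqrt (2 / 3)) s, ∀ q ∈ barlowStacking 1 (Real.sqrt (2 / 3)) s,
              (dist p q = 1 ↔ (0 < dist (Φ p) (Φ q) ∧ dist (Φ p) (Φ q) < 6 / 5))) →
      ∀ᵐ μ ∂P, ∃ S : Set (EuclideanSpace ℝ (Fin 3)),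
        μ = (Measure.count : Measure (EuclideanSpace ℝ (Fin 3))).restrict S ∧
        ∀ x ∈ S, (∃ a : ℝ, 9 / 10 ≤ a ∧ a ≤ 1 ∧ ∃ T : Finset (EuclideanSpace ℝ (Fin 3)),
          (↑T : Set (EuclideanSpace ℝ (Fin 3))) =
            (fun y : EuclideanSpace ℝ (Fin 3) => y - x) ''
              {y : EuclideanSpace ℝ (Fin 3) | y ∈ S ∧ y ≠ x ∧ dist y x ≤ 5 / 4 * a} ∧
          (ShellCloseTo (a / 100) T (Finset.image (fun v : EuclideanSpace ℝ (Fin 3) => a • v) fccKissingPattern) ∨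
            ShellCloseTo (a / 100) T (Finset.image (fun v : EuclideanSpace ℝ (Fin 3) => a • v) hcpKissingPattern))))
    (h9226 : PalmUnimodularRigidity.LayeredLawsSelectHcp) :
    Summit.AtomisticToContinuum.Crystallization.Theses.ReggeStarCoercivity.DefectFreeCrystallizes := by
  -- funnel law rigidity = R1 + (R2a′ + 9227) + 9226
  have hFR : ∀ δ : ℝ, 0 < δ → ∀ P : Measure (Measure (EuclideanSpace ℝ (Fin 3))), IsProbabilityMeasure P →
      (∀ᵐ μ ∂P, IsRootedHardCore δ μ) → IsPointStationaryLaw P →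
      (∫ μ, (∫ y, lennardJones ‖y‖ ∂μ) / 2 ∂P) ≤
        (⨅ Q : PeriodicConfiguration 3, Q.energyPerParticle lennardJones) →
      (∀ᵐ μ ∂P, ∃ S : Set (EuclideanSpace ℝ (Fin 3)),
        μ = (Measure.count : Measure (EuclideanSpace ℝ (Fin 3))).restrict S ∧ ∀ y ∈ S, SetGood S y) →
      ∀ᵐ μ ∂P, ∃ a h : ℝ, ∃ ha : a ≠ 0, ∃ hh : h ≠ 0, 1 / 2 ≤ a ∧ a ≤ 2 ∧ 1 / 2 ≤ h ∧ h ≤ 2 ∧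
        ∃ A : EuclideanSpace ℝ (Fin 3) ≃ₗᵢ[ℝ] EuclideanSpace ℝ (Fin 3),
          (hcpPeriodicConfiguration ha hh).energyPerParticle lennardJones =
            (⨅ Q : PeriodicConfiguration 3, Q.energyPerParticle lennardJones) ∧
          μ = (Measure.count : Measure (EuclideanSpace ℝ (Fin 3))).restrict (A '' hcpStacking a h) := by
    intro δ hδ P hP hcore hstat hE hgood
    -- chart the funnel (R1), exactify (R2a′ + 9227), select and rigidify (9226)
    have hchart : ∀ᵐ μ ∂P, ∃ S : Set (EuclideanSpace ℝ (Fin 3)),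
        μ = (Measure.count : Measure (EuclideanSpace ℝ (Fin 3))).restrict S ∧
        (∀ y ∈ S, SetGood S y) ∧
        ∃ s : ℤ → ℤ, IsHaggSeq s ∧
          ∃ Φ : EuclideanSpace ℝ (Fin 3) → EuclideanSpace ℝ (Fin 3),
            Set.BijOn Φ (barlowStacking 1 (Real.sqrt (2 / 3)) s) S ∧
            ∀ p ∈ barlowStacking 1 (Real.sqrt (2 / 3)) s, ∀ q ∈ barlowStacking 1 (Real.sqrt (2 / 3)) s,
              (dist p q = 1 ↔ (0 < dist (Φ p) (Φ q) ∧ dist (Φ p) (Φ q) < 6 / 5)) := by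
      filter_upwards [hcore, hgood] with μ hc hg
      obtain ⟨S, rfl, hS⟩ := hg
      obtain ⟨S₀, h0, -, hμ⟩ := hc
      have h0S : (0 : EuclideanSpace ℝ (Fin 3)) ∈ S := by
        have h1 : (Measure.count : Measure (EuclideanSpace ℝ (Fin 3))).restrict S {0} ≠ 0 := by
          rw [hμ]
          exact (count_restrict_singleton_ne_zero_iff S₀ 0).2 h0
        exact (count_restrict_singleton_ne_zero_iff S 0).1 h1
      obtain ⟨s, hs, Φ, hΦ, hbond⟩ := FunnelChart.stub_funnelChart S ⟨0, h0S⟩ hS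
      exact ⟨S, rfl, hS, s, hs, Φ, hΦ, hbond⟩
    exact h9226 δ hδ P hP hcore hstat hE
      (chartedFunnelToTube_of_shells hR2a δ hδ P hP hcore hstat hE hchart)
  rw [defectFreeCrystallizes_iff]
  intro hZ
  exact Summit.AtomisticToContinuum.Crystallization.Theorems.chargedPatternCrystallizes_proof
    (ChargeFromFunnelLaw.stub_chargeFromFunnelLaw
      Summit.AtomisticToContinuum.Crystallization.Theorems.PalmGoodLaw.stub_goodLaw hFR hZ) LennardJonesMinimalDistance_holds

end Summit.AtomisticToContinuum.Crystallization.Theorems.PalmGoodLaw.RouteBeta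

end
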